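import Summits.CriticalPhenomena.PercolationContinuityZ3.Theorems.Transplant.SkelPhiCorridorStepsFHab
import Summits.CriticalPhenomena.PercolationContinuityZ3.Theorems.Transplant.SkelPhiCorridorKitsFHabC
import HarnessLib

/-!
# N2 (frames-only node `SamePDropOfSkeletonFrm₁`, OPEN), (S0) kit tier, (C) column, (R-35) successor: **`Skelφ.hkits_schedFHabC`** — the forced-kit
# clauses of every step of a schedule with parking, one x-frame, habitat, KIT CENTRED AT THE COLUMN END: `hkits_schedFHab` (SkelPhiCorridorStepsFHab
# p344093) with the cylinder rows `hfr hκ hkz hRk hΛcyl` deleted, over `hkits_levelFHabC` (SkelPhiCorridorKitsFHabC); the level-width lemmas are imported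
# unchanged.  J12/(R-35): lane INBOX 2026-08-23T03:14:40Z, binder list 03:18:28Z.
builds on p205010 (kernel theorem, internal audit signed; external expert review pending) — nothing in this file uses p205010; nothing here is a
claim about the open node `SamePDropOfSkeletonFrm₁`.
Lane `prim-bschramm`, seat `prim-bschramm-p5` (gen 16; (C) lineage); helper file (`--supports stmt-CriticalPhenomena-4575 --as helper`).
[cite: KozmaNitzan2024, §4 Lemma 10 (pp. 17–21), Lemma 11 (p. 22), Lemma 12 (pp. 23–25)]
-/

noncomputable section

open scoped Classical

namespace Summit.CriticalPhenomena.PercolationContinuityZ3.Theorems.Transplant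

namespace Skelφ

open MeasureTheory
open Literature.Probability.Percolation Literature.Probability.LatticeModels SimpleGraph KNLevels
open Literature.Barriers.CriticalPhenomena (graphBall graphBall_finite mem_graphBall_self graphBall_mono)
open Skel (winGraph winGraph_adj winGraph_le winGraphIn winGraphIn_le KitGeom)
open Literature.Probability.Percolation.KozmaNitzan.Cells (oth oth_ne eq_oth_of_ne oth_oth)
open SkelI (tanOff tanTgt tanTgt_mem)
open ChainPlanar ChainPara

variable {V : Type} [DecidableEq V] {G : SimpleGraph V} [G.LocallyFinite] {φ : V → Site 2}

/-! ## The clauses of every step, kit at the column end -/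

/-- **THE FORCED-KIT CLAUSES OF EVERY STEP OF A SCHEDULE WITH PARKING, ONE x-FRAME, HABITAT** — the `hkits` of `WinChainData.chainF_of_seg` at
`planarWindowIn (lip_runX …) Ω` / `S.toFrame`: from the kit rows, the slot rows `tanOff ≤ j₀`, `j₁ ≤ R′`, `j₁ + reach ≤ R′`, `1 ≤ r₀`, the
window-in-habitat row `hΩball`, the rim cover `hcover`, the count rows, and the per-step per-centre PARKED-OR-ROUTED input `hrouteS`
(under the law `W'`). [cite: KozmaNitzan2024, §4 Lemma 10 (pp. 17–22), Lemma 12 (pp. 23–25)] [this work] -/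
theorem hkits_schedFHabC [Countable V] (hlipφ : Lip G φ) (hstep : Steps G φ) {Δ : ℕ} (hΔ : ∀ v, G.degree v ≤ Δ) {q : unitInterval} {δ : ℝ}
    (hδ : 0 < δ)
    -- the frame, the schedule, the window
    {nL : ℕ} (hnL : 1 ≤ nL) (c₀ : V) (hL : ℤ) {σ : ℤ} (hσ : σ = 1 ∨ σ = -1) {kq : ℕ} (hκL : hL.natAbs ≤ kq * nL)
    (S : ScheduleNP) {w₀ : V} {R r : ℕ}
    -- kit constants
    (P : ApronPrm) {Mz Rs KCmax rs cS cU : ℕ} (hPN : kq + 3 ≤ P.N) (hA : P.A = (Mz + 1 : ℕ) * (shearUnit nL hL : ℤ) + 1)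
    (hdD : P.d + 2 ≤ shellD P) (hDρ : Rs + 1 ≤ shellD P) (hKCmax : (shellD P + Mz + 1) * (kq + 1) ≤ KCmax)
    (hT : (shellD P : ℤ) + KCmax + Rs ≤ tanOff P.ℓs P.M)
    (hr₀ : P.N * (tanOff P.ℓs P.M + 2) + P.N * P.d + (KCmax + Rs) ≤ P.r₀) (hR : P.r₀ ≤ R) (hr₀1 : 1 ≤ P.r₀)
    (hrs : 1 + (P.N * (tanOff P.ℓs P.M + 2) + P.N * P.d + (KCmax + Rs)) ≤ rs)
    (hcS : (P.N + 1) * (tanOff P.ℓs P.M + 1) + (P.N + 1) * P.d + (KCmax + 1) + cU ≤ cS)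
    (hreach : r + (P.N * (tanOff P.ℓs P.M + 1) + P.N * P.d + KCmax) ≤ P.r₀)
    -- the short region and the zone datum
    (Rg : V → Finset V) (hRg : ∀ c, ∀ u ∈ Rg c, u ∈ graphBall G c Rs) (hRgcard : ∀ c, (Rg c).card ≤ cU) (hcU1 : 1 ≤ cU)
    (Λc : V → ℕ → Finset V) (kz : ℕ) (hΛRg : ∀ c, Λc c kz ⊆ Rg c) (hzconn : ∀ c, ∀ s ∈ Λc c kz, PathIn G (↑(Λc c kz) : Set V) c s)
    (hcz : ∀ c, c ∈ Λc c kz)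
    -- the chain data and its slot rows
    (Pd : WinChainData V) (hj0 : tanOff P.ℓs P.M ≤ Pd.j₀) (hj1R : Pd.j₁ ≤ S.R')
    (hE : Pd.j₁ + (P.N * (tanOff P.ℓs P.M + 1) + P.N * P.d + KCmax) ≤ S.R')
    (kk : ℕ) (hN : kk * (Δ + 1) ^ (2 * rs) ≤ Pd.N) (hk : (1 - (q : ℝ) ^ (1 + Δ * cS + cS * cU)) ^ kk ≤ δ)
    -- the habitat: the plain windows over the prism lie in it; the rim of every region window is covered by `Rim`
    {Ω : Finset V} (hΩball : ∀ v ∈ graphBall G w₀ R, runX φ c₀ nL hL σ v ∈ S.prism → v ∈ Ω)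
    (hcover : ∀ k ≤ S.N, ∀ v ∈ WinIn (runX φ c₀ nL hL σ) Ω (S.region k), v ∉ graphBall G w₀ (R - P.r₀) → v ∈ Pd.Rim k)
    -- THE PER-STEP PER-CENTRE INPUT (under the law `W'`; built by the caller from a sub-box law on the region windows)
    {W' : Sym2 V → unitInterval}
    (hrouteS : ∀ k ≤ S.N, ∀ c : V,
      runX φ c₀ nL hL σ c ∈ Finset.Icc (S.lo k - ((S.R' : ℕ) : Site 2)) (S.hi k + ((S.R' : ℕ) : Site 2)) → c ∈ graphBall G w₀ (R - r) →
      c ∈ WinIn (runX φ c₀ nL hL σ) Ω (ScheduleNP.core S (k + 1)) ∪ Pd.Rim k ∨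
      ∃ Qt Ft : Finset V, Ft ⊆ WinIn (runX φ c₀ nL hL σ) Ω (ScheduleNP.core S (k + 1)) ∪ Pd.Rim k ∧
        Qt ⊆ WinIn (runX φ c₀ nL hL σ) Ω (S.region k) ∧ 1 - δ ^ 3 ≤ (prodBernoulli W').real (linkIn (↑Qt : Set V) (Λc c kz) Ft)) :
    ∀ k ≤ S.N, ∀ j ∈ Finset.Icc Pd.j₀ Pd.j₁, ∃ (σ' : SData V) (Sz : Finset V),
      SHyp (Pd.stepLF (planarWindowIn (lip_runX hlipφ hσ hnL c₀ hL) Ω) S.toFrame k) j σ' ∧ σ'.N ≤ Pd.N ∧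
      (1 - (q : ℝ) ^ σ'.sB) ^ σ'.k ≤ δ ∧ Sz ⊆ (planarWindowIn (lip_runX hlipφ hσ hnL c₀ hL) Ω).stepDF S.toFrame k ∧
      (∀ x ∈ σ'.K, σ'.face x ⊆ Sz) ∧
      RelayClause (Pd.stepLF (planarWindowIn (lip_runX hlipφ hσ hnL c₀ hL) Ω) S.toFrame k) W' j σ' Sz
        (Pd.coreEF (planarWindowIn (lip_runX hlipφ hσ hnL c₀ hL) Ω) S.toFrame k) ((planarWindowIn (lip_runX hlipφ hσ hnL c₀ hL) Ω).stepDF S.toFrame k) δ := by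
  intro k hkN j hj
  set ψ := runX φ c₀ nL hL σ with hψ
  set hlipR : Lip G ψ := lip_runX hlipφ hσ hnL c₀ hL
  obtain ⟨hj₀, hj₁⟩ := Finset.mem_Icc.1 hj
  have hjR : j ≤ S.R' := hj₁.trans hj1R
  -- the planar level box lies in the region, hence in the prism
  have hlev : Finset.Icc (S.lo k - ((j : ℕ) : Site 2)) (S.hi k + ((j : ℕ) : Site 2)) ⊆ S.region k := S.level_subset_region hkN hjR
  have hregP : S.region k ⊆ S.prism := S.sub_prism k hkN
  -- the plain level lies in the habitat; the habitat level lies in the region window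
  have hfull : winLevel G ψ w₀ R (S.lo k) (S.hi k) j ⊆ Ω := fun v hv => by
    obtain ⟨hvB, hvP⟩ := (mem_Win G _).1 hv
    exact hΩball v hvB (hregP (hlev hvP))
  have hXD : winLevelIn ψ Ω (S.lo k) (S.hi k) j ⊆ WinIn ψ Ω (S.region k) := WinIn_mono _ subset_rfl hlev
  -- the rim: far plain-level vertices and inner neighbours of padded contacts are covered
  have hfarT : ∀ v ∈ winLevel G ψ w₀ R (S.lo k) (S.hi k) j, v ∉ graphBall G w₀ (R - P.r₀) →
      v ∈ WinIn ψ Ω (ScheduleNP.core S (k + 1)) ∪ Pd.Rim k := by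
    intro v hv hfar
    have hD : v ∈ WinIn ψ Ω (S.region k) := hXD ((mem_winLevelIn_iff _).2 ⟨hfull hv, ((mem_Win G _).1 hv).2⟩)
    exact Finset.mem_union_right _ (hcover k hkN v hD hfar)
  have hpadT : ∀ x ∈ outerBoundary (winGraphIn G Ω) (winLevelIn ψ Ω (S.lo k) (S.hi k) j),
      x ∉ outerBoundary (winGraph G w₀ R) (winLevel G ψ w₀ R (S.lo k) (S.hi k) j) →
      inNbrIn G ψ Ω (Finset.Icc (S.lo k - (j : Site 2)) (S.hi k + (j : Site 2))) x ∈ WinIn ψ Ω (ScheduleNP.core S (k + 1)) ∪ Pd.Rim k := by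
    intro x hx hxn
    have hD : inNbrIn G ψ Ω (Finset.Icc (S.lo k - (j : Site 2)) (S.hi k + (j : Site 2))) x ∈ WinIn ψ Ω (S.region k) :=
      hXD (inNbrIn_mem_winLevelIn hx)
    have hfar := inNbrIn_not_mem_graphBall hx hxn (d := R - P.r₀) (by omega)
    exact Finset.mem_union_right _ (hcover k hkN _ hD hfar)
  -- the level widths and the reach row
  obtain ⟨hwide, hdw, hDw⟩ := level_widthsNP S (k := k) (by omega) P (KCmax := KCmax) (Rs := Rs) (j := j) (hj0.trans hj₀) hdD hT
  have hEj : j + (P.N * (tanOff P.ℓs P.M + 1) + P.N * P.d + KCmax) ≤ S.R' := by omega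
  -- the clause of the level, from the per-centre input
  rw [stepLF_toFrame_eq, stepDF_toFrame_eq, coreEF_toFrame_eq]
  exact hkits_levelFHabC hlipφ hstep hΔ hδ hnL c₀ hL hσ hκL P hPN hA hdD hDρ hKCmax hwide hdw hDw hT hr₀ hR hrs hcS hEj hreach
    Rg hRg hRgcard hcU1 Λc kz hΛRg hzconn hcz hfull kk Pd.o Pd.Sfin hXD hpadT hfarT hN hk (hrouteS k hkN)

end Skelφ

end Summit.CriticalPhenomena.PercolationContinuityZ3.Theorems.Transplant

end
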